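import Summits.AtomisticToContinuum.Crystallization.Theorems.FluxTubeKeplerFloorGivesLayered
import Summits.AtomisticToContinuum.Crystallization.Theorems.FluxTubeKeplerFluxCellKeplerSingleScale

/-!
# F3 witness for the forward rung `PosTolRung` (tolerance ladder over `FluxTubeKepler.FloorGivesLayered`)

`TolRung 0` — FLOOR + the defect budget at EVERY tolerance force periodic windows — is the proved floor:
the seed `FluxTubeKeplerFloorGivesLayered.FloorGivesLayered_proof` (stmt-AtomisticToContinuum-15223)
followed by the proved `FluxTubeKepler.PeriodicGivenLayered_holds`.  Self-contained copy (sub-namespace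
`Special`) of the five definitions of `Lines/PosTolRung.lean`, so that this file elaborates on its own;
the canonical declarations `ToleranceLadder.TolRung`, `ToleranceLadder.tolRung_zero` live there with the
same text.  No `sorry`.
-/

noncomputable section

namespace Summit.AtomisticToContinuum.Crystallization.Cruxes.FluxCellKepler.ToleranceLadder.Special

open Filter Topology
open Literature.MathematicalPhysics.StatisticalMechanics
open Summit.AtomisticToContinuum.Crystallization.Theorems.FluxCellKeplerSingleScale (LayeredGood)

local notation "E3" => EuclideanSpace ℝ (Fin 3)

/-- FLOOR(P₀) (verbatim copy of `ToleranceLadder.Floor` in `Lines/PosTolRung.lean`). -/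
def Floor (P₀ : PeriodicConfiguration 3) : Prop :=
  ∀ (N : ℕ) (x : Fin N → E3), IsGroundState lennardJones x →
    (N : ℝ) * P₀.energyPerParticle lennardJones ≤ interactionEnergy lennardJones x

/-- BUDGET(P₀) at tolerances `η ≥ η₀` (verbatim copy of `ToleranceLadder.Budget`). -/
def Budget (η₀ : ℝ) (P₀ : PeriodicConfiguration 3) : Prop :=
  ∀ R η : ℝ, 0 < R → η₀ ≤ η → 0 < η → ∃ c : ℝ, 0 < c ∧
    ∀ (N : ℕ) (x : Fin N → E3), IsGroundState lennardJones x →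
      c * (Nat.card {i : Fin N // ¬ LayeredGood R η x i} : ℝ) ≤
        interactionEnergy lennardJones x - (N : ℝ) * P₀.energyPerParticle lennardJones

/-- Periodic windows along `x` (verbatim copy of `ToleranceLadder.HasPeriodicWindows`). -/
def HasPeriodicWindows (x : (N : ℕ) → (Fin N → E3)) : Prop :=
  ∃ P : PeriodicConfiguration 3, ∀ R ε : ℝ, 0 < ε → ∃ᶠ N in atTop, ∃ t : E3,
    (∀ s ∈ P.points, ‖s‖ ≤ R → ∃ i : Fin N, dist (x N i + t) s ≤ ε) ∧
    (∀ i : Fin N, ‖x N i + t‖ ≤ R → ∃ s ∈ P.points, dist (x N i + t) s ≤ ε)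

/-- The graded family (verbatim copy of `ToleranceLadder.TolRung`). -/
def TolRung (η₀ : ℝ) : Prop :=
  ∀ P₀ : PeriodicConfiguration 3, Floor P₀ → Budget η₀ P₀ →
    ∀ x : (N : ℕ) → (Fin N → E3), (∀ N, IsGroundState lennardJones (x N)) → HasPeriodicWindows x

/-- The deciding rung (verbatim copy of `ToleranceLadder.PosTolRung`). -/
def PosTolRung : Prop := ∃ η₀ : ℝ, 0 < η₀ ∧ TolRung η₀

/-- **F3 — the rung family at the floor value `η₀ = 0` is the proved floor.** -/
theorem tolRung_zero : TolRung 0 := fun P₀ hF hB x hx =>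
  Theses.FluxTubeKepler.PeriodicGivenLayered_holds x hx
    (Theorems.FluxTubeKeplerFloorGivesLayered.FloorGivesLayered_proof P₀ hF
      (fun R η hR hη => hB R η hR hη.le hη) x hx)

example : TolRung 0 := tolRung_zero

/-- … and the deciding rung gives the floor value back (antitonicity of the family). -/
theorem tolRung_zero_of_posTolRung (h : PosTolRung) : TolRung 0 := by
  obtain ⟨η₀, hη₀, H⟩ := h
  exact fun P₀ hF hB x hx => H P₀ hF (fun R η hR hη₁ hη => hB R η hR (hη₀.le.trans hη₁) hη) x hx

end Summit.AtomisticToContinuum.Crystallization.Cruxes.FluxCellKepler.ToleranceLadder.Special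

end
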